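import Literature.NumberTheory.Sieve.PolymathGEHTupleDecomp
import Literature.NumberTheory.Sieve.PolymathGEHTypeII
import HarnessLib

/-!
# The tuple pieces of §4.5: majorants, supports and the exceptional integers (static layer)

Trunk AntSieve, tooling toward the named fact `Literature.NumberTheory.Sieve.weakDHL_three_two_of_GEH`
(D. H. J. Polymath, Res. Math. Sci. 1:12 (2014) = arXiv:1407.4897, Theorem 3.2(xii)).

Fixed-`x` estimates for the level-of-distribution bound (local) of §4.5 (p. 17) via the tuple
decomposition of `PolymathGEHTupleDecomp.lean`.  For a tuple `τ : Fin (s+1) → ℕ` the majorant is the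
convolution `Conv_τ = 1_{tupleProducts (pieces of τ ∘ castSucc)} ⋆ 1_{P_{τ last}}` (`tupleConv`):

* `iSup_abs_apDiscrepancy_le_of_majorant` — the one inequality used for every piece: if
  `|u - c' Conv| ≤ H Conv` pointwise, `u` lives on `[1, X₂]` and `Conv` on `[1, N]`, then
  `max_a |Δ(u; X₂)| ≤ (|c'| + H) max_a |Δ(Conv; N)| + 2H ‖Conv‖₁/φ(q)` (cut-offs moved beyond the
  supports, then the straddle bound `abs_apDiscrepancy_le_of_abs_le`);
* `tupleConv_le_omega`, `idxList_eq_of_tupleConv_pos` — `Conv_τ(n) ≤ ω(n)`, and `Conv_τ(n) > 0`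
  forces `idxList n = ofFn τ`: the supports of the `Conv_τ` are DISJOINT in `τ`, so
  `Σ_τ Conv_τ(n) ≤ s + 1` (`sum_tupleConv_le`) — this replaces the counting of tuples of p. 17
  ("there are `O(log^{A(r-1)} x)` tuples with one repeated `j_i`, or … meeting the boundary") by a
  count of INTEGERS;
* `exists_close_primes_of_not_strictMono` — if `τ` is not strictly increasing, every `n` with
  `idxList n = ofFn τ` is divisible by `p p'` with two primes `c_j < p ≤ p' ≤ c_{j+1}` of one piece.

## References

* [Polymath8b2014] D. H. J. Polymath, Res. Math. Sci. 1 (2014), Art. 12 = arXiv:1407.4897,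
  §4.5, p. 17.
-/

noncomputable section

open Finset
open scoped ArithmeticFunction.omega

namespace Literature.NumberTheory.Sieve

open scoped Classical

/-! ### The one inequality per piece -/

/-- **Majorant bound for one piece.**  If `|u(n) - c' Conv(n)| ≤ H Conv(n)` for all `n` (`H ≥ 0`,
`Conv ≥ 0`), `u` vanishes beyond `X₂` and `Conv` beyond `N`, then for `q ≥ 1`
`max_a |Δ(u; X₂; a (q))| ≤ (|c'| + H) max_a |Δ(Conv; N; a (q))| + 2H (Σ_{n ≤ N} Conv(n))/φ(q)`. [cite: Polymath8b2014, §4.5, p. 17] -/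
theorem iSup_abs_apDiscrepancy_le_of_majorant {u Conv : ℕ → ℝ} {c' H : ℝ} (hH : 0 ≤ H)
    (hmaj : ∀ n, |u n - c' * Conv n| ≤ H * Conv n) (hConv0 : ∀ n, 0 ≤ Conv n)
    {X₂ N : ℕ} (hu : ∀ n, X₂ < n → u n = 0) (hC : ∀ n, N < n → Conv n = 0) {q : ℕ} (hq : 1 ≤ q) :
    (⨆ a : (ZMod q)ˣ, |apDiscrepancy u X₂ q a|) ≤
      (|c'| + H) * (⨆ a : (ZMod q)ˣ, |apDiscrepancy Conv N q a|) +
        2 * H * (∑ n ∈ Icc 1 N, Conv n) / Nat.totient q := by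
  haveI : NeZero q := ⟨by omega⟩
  have hφ0 : (0 : ℝ) < Nat.totient q := by exact_mod_cast Nat.totient_pos.2 (by omega)
  have hbdd : BddAbove (Set.range fun a : (ZMod q)ˣ => |apDiscrepancy Conv N q a|) :=
    (Set.finite_range _).bddAbove
  have hS0 : 0 ≤ ∑ n ∈ Icc 1 N, Conv n := Finset.sum_nonneg fun n _ => hConv0 n
  refine ciSup_le fun a => ?_
  set M := max X₂ N with hM
  set v : ℕ → ℝ := fun n => u n - c' * Conv n with hv
  -- move all cut-offs to `M`
  have h1 : apDiscrepancy u X₂ q a = apDiscrepancy u M q a :=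
    (apDiscrepancy_eq_of_support hu (le_max_left _ _) q a).symm
  have h2 : apDiscrepancy Conv M q a = apDiscrepancy Conv N q a :=
    apDiscrepancy_eq_of_support hC (le_max_right _ _) q a
  have h3 : apDiscrepancy u M q a = c' * apDiscrepancy Conv M q a + apDiscrepancy v M q a := by
    have hfun : u = fun n => c' * Conv n + v n := funext fun n => by simp [hv]
    rw [hfun, apDiscrepancy_add, ← apDiscrepancy_smul]
  -- the straddle bound for `v`
  have h4 := abs_apDiscrepancy_le_of_abs_le (γ := v) (G := fun n => H * Conv n) (fun n => hmaj n) M hq a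
  have h5 : apDiscrepancy (fun n => H * Conv n) M q a = H * apDiscrepancy Conv N q a := by
    rw [← h2, ← apDiscrepancy_smul]
  have h6 : ∑ n ∈ Icc 1 M, H * Conv n = H * ∑ n ∈ Icc 1 N, Conv n := by
    rw [← Finset.mul_sum]
    congr 1
    symm
    refine Finset.sum_subset (Finset.Icc_subset_Icc_right (le_max_right _ _)) fun n hn hn' => ?_
    rw [Finset.mem_Icc] at hn hn'
    exact hC n (by omega)
  rw [h5, h6] at h4
  have hsup : |apDiscrepancy Conv N q a| ≤ ⨆ a : (ZMod q)ˣ, |apDiscrepancy Conv N q a| := le_ciSup hbdd a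
  have hsup0 : 0 ≤ ⨆ a : (ZMod q)ˣ, |apDiscrepancy Conv N q a| := Real.iSup_nonneg fun _ => abs_nonneg _
  rw [h1, h3, h2]
  calc |c' * apDiscrepancy Conv N q a + apDiscrepancy v M q a|
      ≤ |c'| * |apDiscrepancy Conv N q a| + |apDiscrepancy v M q a| := by
        rw [← abs_mul]; exact abs_add_le _ _
    _ ≤ |c'| * |apDiscrepancy Conv N q a| +
          (H * apDiscrepancy Conv N q a + 2 / (Nat.totient q : ℝ) * (H * ∑ n ∈ Icc 1 N, Conv n)) :=
        add_le_add le_rfl h4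
    _ ≤ |c'| * (⨆ a : (ZMod q)ˣ, |apDiscrepancy Conv N q a|) +
          (H * (⨆ a : (ZMod q)ˣ, |apDiscrepancy Conv N q a|) +
            2 / (Nat.totient q : ℝ) * (H * ∑ n ∈ Icc 1 N, Conv n)) := by
        have := le_abs_self (apDiscrepancy Conv N q a)
        nlinarith [abs_nonneg c', mul_le_mul_of_nonneg_left hsup (abs_nonneg c'),
          mul_le_mul_of_nonneg_left (this.trans hsup) hH]
    _ = (|c'| + H) * (⨆ a : (ZMod q)ˣ, |apDiscrepancy Conv N q a|) +
          2 * H * (∑ n ∈ Icc 1 N, Conv n) / Nat.totient q := by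
        field_simp
        ring

/-! ### The convolution majorant of a tuple -/

section Conv

variable {c : ℕ → ℕ} {J : ℕ}

/-- The majorant of the tuple `τ : Fin (s+1) → ℕ`:
`Conv_τ = 1_{tupleProducts (pieces of τ ∘ castSucc)} ⋆ 1_{P_{τ (last s)}}`. [cite: Polymath8b2014, §4.5, p. 17] -/
def tupleConv (c : ℕ → ℕ) {s : ℕ} (τ : Fin (s + 1) → ℕ) : ArithmeticFunction ℝ :=
  setIndicatorAF (tupleProducts (tuplePieces c fun i : Fin s => τ i.castSucc)) *
    setIndicatorAF (gridPiece c (τ (Fin.last s)))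

/-- `Conv_τ ≥ 0`. [folklore] -/
theorem tupleConv_nonneg (c : ℕ → ℕ) {s : ℕ} (τ : Fin (s + 1) → ℕ) (n : ℕ) : 0 ≤ tupleConv c τ n := by
  rw [tupleConv, ArithmeticFunction.mul_apply]
  refine Finset.sum_nonneg fun x _ => mul_nonneg ?_ ?_ <;>
    (rw [setIndicatorAF_apply]; split_ifs <;> norm_num)

/-- **`Conv_τ(n) ≤ ω(n)`**: a term of the convolution is determined by its prime second factor. [folklore] -/
theorem tupleConv_le_omega (c : ℕ → ℕ) {s : ℕ} (τ : Fin (s + 1) → ℕ) (n : ℕ) :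
    tupleConv c τ n ≤ ω n := by
  rw [tupleConv, ArithmeticFunction.mul_apply]
  set P := gridPiece c (τ (Fin.last s)) with hP
  calc ∑ x ∈ n.divisorsAntidiagonal, setIndicatorAF (tupleProducts (tuplePieces c fun i : Fin s => τ i.castSucc)) x.1 *
          setIndicatorAF P x.2
      ≤ ∑ x ∈ n.divisorsAntidiagonal, (if x.2 ∈ P then (1 : ℝ) else 0) := by
        refine Finset.sum_le_sum fun x _ => ?_
        rw [setIndicatorAF_apply, setIndicatorAF_apply]
        by_cases h2 : x.2 ∈ P
        · rw [if_pos h2]; split_ifs <;> norm_num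
        · have hn2 : ¬ (x.2 ∈ P ∧ x.2 ≠ 0) := fun h => h2 h.1
          rw [if_neg h2, if_neg hn2, mul_zero]
    _ = ((n.divisorsAntidiagonal.filter fun x => x.2 ∈ P).card : ℝ) := by
        rw [Finset.card_eq_sum_ones, Nat.cast_sum, Finset.sum_filter]; push_cast; rfl
    _ ≤ (n.primeFactors.card : ℝ) := by
        have h : (n.divisorsAntidiagonal.filter fun x => x.2 ∈ P).card ≤ n.primeFactors.card := by
          refine Finset.card_le_card_of_injOn (fun x => x.2) (fun x hx => ?_) (fun x hx y hy hxy => ?_)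
          · rw [Finset.coe_filter, Set.mem_setOf_eq, Nat.mem_divisorsAntidiagonal] at hx
            rw [Finset.mem_coe, Nat.mem_primeFactors]
            exact ⟨((mem_gridPiece c).1 hx.2).2.2, ⟨x.1, by rw [mul_comm]; exact hx.1.1.symm⟩, hx.1.2⟩
          · have hxy' : x.2 = y.2 := hxy
            rw [Finset.coe_filter, Set.mem_setOf_eq, Nat.mem_divisorsAntidiagonal] at hx hy
            have hx2 : x.2 ≠ 0 := ((mem_gridPiece c).1 hx.2).2.2.ne_zero
            have h1 : x.1 = y.1 := by
              have := hx.1.1.trans hy.1.1.symm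
              rw [hxy'] at this
              exact Nat.eq_of_mul_eq_mul_right (Nat.pos_of_ne_zero (hxy' ▸ hx2)) this
            exact Prod.ext h1 hxy'
        exact_mod_cast h
    _ = ω n := by rw [ArithmeticFunction.cardDistinctFactors_apply, Nat.primeFactors, List.card_toFinset]

/-- If a list of primes matches the pieces of a monotone tuple (largest first) and has product `n`, then
`idxList n = ofFn τ`. [folklore] -/
theorem idxList_eq_of_forall₂ (hc : Monotone c) {r : ℕ} {τ : Fin r → ℕ} (hτ : Monotone τ)
    (hτJ : ∀ i, τ i ≤ J) {ps : List ℕ} (hps : List.Forall₂ (fun q P => q ∈ P) ps (tuplePieces c τ))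
    {n : ℕ} (hprod : ps.prod = n) : idxList c J n = List.ofFn τ := by
  set ls := ps.reverse with hls
  have hls2 : List.Forall₂ (fun q P => q ∈ P) ls (List.ofFn fun i => gridPiece c (τ i)) := by
    have := List.forall₂_reverse_iff.2 hps
    rwa [tuplePieces, List.reverse_reverse] at this
  have hlen : ls.length = r := by rw [hls2.length_eq, List.length_ofFn]
  have hget : ∀ (i : ℕ) (hi : i < ls.length), ls[i] ∈ gridPiece c (τ ⟨i, hlen ▸ hi⟩) := by
    intro i hi
    have h := (List.forall₂_iff_get.1 hls2).2 i hi (by rw [List.length_ofFn]; exact hlen ▸ hi)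
    simpa using h
  have hprime : ∀ p ∈ ls, p.Prime := by
    intro p hp
    obtain ⟨i, hi, rfl⟩ := List.getElem_of_mem hp
    exact ((mem_gridPiece c).1 (hget i hi)).2.2
  have hlsprod : ls.prod = n := by rw [hls, List.prod_reverse, hprod]
  have hperm : n.primeFactorsList.Perm ls := (Nat.primeFactorsList_unique hlsprod hprime).symm
  -- `ls.map gridIndex = ofFn τ`
  have hmap : ls.map (gridIndex c J) = List.ofFn τ := by
    apply List.ext_getElem
    · rw [List.length_map, List.length_ofFn, hlen]
    · intro i h1 h2
      rw [List.getElem_map, List.getElem_ofFn]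
      have hi : i < ls.length := by rwa [List.length_map] at h1
      exact gridIndex_of_mem_gridPiece hc (hτJ _) (hget i hi)
  have hperm' : (idxList c J n).Perm (List.ofFn τ) := by
    rw [idxList, ← hmap]
    exact hperm.map _
  exact hperm'.eq_of_sortedLE (idxList_sortedLE n) (List.sortedLE_ofFn_iff.2 hτ)

/-- **The support of `Conv_τ`**: `Conv_τ(n) > 0` forces `idxList n = ofFn τ` (for monotone `τ` with
entries `≤ J`). [cite: Polymath8b2014, §4.5, p. 17] -/
theorem idxList_eq_of_tupleConv_pos (hc : Monotone c) {s : ℕ} {τ : Fin (s + 1) → ℕ} (hτ : Monotone τ)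
    (hτJ : ∀ i, τ i ≤ J) {n : ℕ} (hpos : 0 < tupleConv c τ n) : idxList c J n = List.ofFn τ := by
  rw [tupleConv, ArithmeticFunction.mul_apply] at hpos
  obtain ⟨x, hx, hxpos⟩ := Finset.exists_lt_of_sum_lt (s := n.divisorsAntidiagonal) (f := fun _ => (0 : ℝ))
    (g := fun x => setIndicatorAF (tupleProducts (tuplePieces c fun i : Fin s => τ i.castSucc)) x.1 *
      setIndicatorAF (gridPiece c (τ (Fin.last s))) x.2) (by rw [Finset.sum_const_zero]; exact hpos)
  rw [Nat.mem_divisorsAntidiagonal] at hx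
  have h1 : x.1 ∈ tupleProducts (tuplePieces c fun i : Fin s => τ i.castSucc) := by
    by_contra h
    rw [setIndicatorAF_apply, if_neg (fun h' => h h'.1), zero_mul] at hxpos
    exact lt_irrefl _ hxpos
  have h2 : x.2 ∈ gridPiece c (τ (Fin.last s)) := by
    by_contra h
    have hn2 : ¬ (x.2 ∈ gridPiece c (τ (Fin.last s)) ∧ x.2 ≠ 0) := fun h' => h h'.1
    rw [setIndicatorAF_apply, setIndicatorAF_apply, if_neg hn2, mul_zero] at hxpos
    exact lt_irrefl _ hxpos
  obtain ⟨qs, hqs, hprod⟩ := exists_forall₂_of_mem_tupleProducts h1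
  refine idxList_eq_of_forall₂ hc hτ hτJ (ps := x.2 :: qs) ?_ ?_
  · rw [tuplePieces_succ]
    exact List.Forall₂.cons h2 hqs
  · rw [List.prod_cons, hprod, mul_comm]
    exact hx.1

/-- **Disjoint supports**: `Σ_{τ ∈ monoTuples (s+1) J} Conv_τ(n) ≤ s + 1` for every `n` (at most one
`τ` has `Conv_τ(n) > 0`, and then `n` has `s + 1` prime factors). [cite: Polymath8b2014, §4.5, p. 17] -/
theorem sum_tupleConv_le (hc : Monotone c) (s J : ℕ) (n : ℕ) :
    ∑ τ ∈ monoTuples (s + 1) J, tupleConv c τ n ≤ s + 1 := by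
  by_cases hex : ∃ τ ∈ monoTuples (s + 1) J, 0 < tupleConv c τ n
  · obtain ⟨τ₀, hτ₀, hpos⟩ := hex
    obtain ⟨hτ₀J, hτ₀m⟩ := mem_monoTuples.1 hτ₀
    have hidx := idxList_eq_of_tupleConv_pos hc hτ₀m hτ₀J hpos
    rw [Finset.sum_eq_single_of_mem τ₀ hτ₀]
    · calc tupleConv c τ₀ n ≤ ω n := tupleConv_le_omega c τ₀ n
        _ ≤ (n.primeFactorsList.length : ℝ) := by
            rw [ArithmeticFunction.cardDistinctFactors_apply]
            exact_mod_cast (List.dedup_sublist _).length_le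
        _ = s + 1 := by
            have : (idxList c J n).length = s + 1 := by rw [hidx, List.length_ofFn]
            rw [idxList, List.length_map] at this
            exact_mod_cast this
    · intro τ hτ hne
      obtain ⟨hτJ, hτm⟩ := mem_monoTuples.1 hτ
      by_contra hne0
      have hpos' : 0 < tupleConv c τ n := lt_of_le_of_ne (tupleConv_nonneg c τ n) (Ne.symm hne0)
      have := idxList_eq_of_tupleConv_pos hc hτm hτJ hpos'
      rw [hidx] at this
      exact hne (List.ofFn_injective this).symm
  · push Not at hex
    have h0 : ∀ τ ∈ monoTuples (s + 1) J, tupleConv c τ n = 0 := fun τ hτ =>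
      le_antisymm (hex τ hτ) (tupleConv_nonneg c τ n)
    rw [Finset.sum_eq_zero h0]
    positivity

/-- **The support of `Conv_τ` lies in the tuple product set** (any tuple). [folklore] -/
theorem mem_tupleProducts_of_tupleConv_pos (c : ℕ → ℕ) {s : ℕ} (τ : Fin (s + 1) → ℕ) {n : ℕ}
    (hpos : 0 < tupleConv c τ n) : n ∈ tupleProducts (tuplePieces c τ) := by
  rw [tupleConv, ArithmeticFunction.mul_apply] at hpos
  obtain ⟨x, hx, hxpos⟩ := Finset.exists_lt_of_sum_lt (s := n.divisorsAntidiagonal) (f := fun _ => (0 : ℝ))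
    (g := fun x => setIndicatorAF (tupleProducts (tuplePieces c fun i : Fin s => τ i.castSucc)) x.1 *
      setIndicatorAF (gridPiece c (τ (Fin.last s))) x.2) (by rw [Finset.sum_const_zero]; exact hpos)
  rw [Nat.mem_divisorsAntidiagonal] at hx
  have h1 : x.1 ∈ tupleProducts (tuplePieces c fun i : Fin s => τ i.castSucc) := by
    by_contra h
    rw [setIndicatorAF_apply, if_neg (fun h' => h h'.1), zero_mul] at hxpos
    exact lt_irrefl _ hxpos
  have h2 : x.2 ∈ gridPiece c (τ (Fin.last s)) := by
    by_contra h
    have hn2 : ¬ (x.2 ∈ gridPiece c (τ (Fin.last s)) ∧ x.2 ≠ 0) := fun h' => h h'.1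
    rw [setIndicatorAF_apply, setIndicatorAF_apply, if_neg hn2, mul_zero] at hxpos
    exact lt_irrefl _ hxpos
  rw [tuplePieces_succ, tupleProducts_cons, Finset.mem_image]
  exact ⟨x, Finset.mem_product.2 ⟨h1, h2⟩, hx.1⟩

/-- Prime factors of members of a tuple product set lie in `(c_0, c_{J+1}]` (entries `≤ J`). [folklore] -/
theorem primeFactors_of_mem_tupleProducts (hc : Monotone c) {r : ℕ} {τ : Fin r → ℕ} (hτJ : ∀ i, τ i ≤ J)
    {n : ℕ} (hmem : n ∈ tupleProducts (tuplePieces c τ)) :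
    ∀ p ∈ n.primeFactorsList, c 0 < p ∧ p ≤ c (J + 1) := by
  intro p hp
  have hpp : p.Prime := Nat.prime_of_mem_primeFactorsList hp
  obtain ⟨Q, hQ, hpQ⟩ := exists_mem_of_prime_dvd_tupleProducts (prime_of_mem_tuplePieces c τ) hmem hpp
    (Nat.dvd_of_mem_primeFactorsList hp)
  rw [tuplePieces, List.mem_reverse, List.mem_ofFn] at hQ
  obtain ⟨i, rfl⟩ := hQ
  obtain ⟨hl, hu, -⟩ := (mem_gridPiece c).1 hpQ
  exact ⟨lt_of_le_of_lt (hc (Nat.zero_le _)) hl, hu.trans (hc (by have := hτJ i; omega))⟩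

/-- `Conv_τ` vanishes beyond the top of the box `∏ c_{τ i + 1}` (any tuple). [folklore] -/
theorem tupleConv_eq_zero_of_lt (c : ℕ → ℕ) {s : ℕ} (τ : Fin (s + 1) → ℕ) {n : ℕ}
    (hn : ∏ i, c (τ i + 1) < n) : tupleConv c τ n = 0 := by
  by_contra hne
  have hpos : 0 < tupleConv c τ n := lt_of_le_of_ne (tupleConv_nonneg c τ n) (Ne.symm hne)
  have hmem := mem_tupleProducts_of_tupleConv_pos c τ hpos
  exact absurd (le_prod_of_mem_tupleProducts hmem) (not_le.2 hn)

end Conv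

/-! ### Tuples with a repeated index: two close prime factors -/

section Repeated

variable {c : ℕ → ℕ} {J : ℕ}

/-- A monotone tuple which is not strictly monotone has two equal consecutive entries. [folklore] -/
theorem exists_eq_succ_of_not_strictMono {r : ℕ} {τ : Fin r → ℕ} (hτ : Monotone τ) (hns : ¬ StrictMono τ) :
    ∃ i : ℕ, ∃ h : i + 1 < r, τ ⟨i, by omega⟩ = τ ⟨i + 1, h⟩ := by
  by_contra hno
  push Not at hno
  apply hns
  -- strictly increasing on consecutive indices
  have hstep : ∀ (i : ℕ) (h : i + 1 < r), τ ⟨i, by omega⟩ < τ ⟨i + 1, h⟩ := fun i h =>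
    lt_of_le_of_ne (hτ (Fin.mk_le_mk.2 (Nat.le_succ i))) (hno i h)
  intro a b hab
  have key : ∀ (k : ℕ) (hk : (a : ℕ) + k + 1 < r), τ a < τ ⟨(a : ℕ) + k + 1, hk⟩ := by
    intro k
    induction k with
    | zero => intro hk; exact hstep a hk
    | succ k ih =>
      intro hk
      have h1 := ih (by omega)
      have h2 := hstep ((a : ℕ) + k + 1) (by omega)
      exact h1.trans (by simpa [Nat.add_assoc] using h2)
  have hlt : (a : ℕ) < b := hab
  obtain ⟨k, hk⟩ : ∃ k, (b : ℕ) = (a : ℕ) + k + 1 := ⟨b - a - 1, by omega⟩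
  have := key k (by omega)
  have hb : b = ⟨(a : ℕ) + k + 1, by omega⟩ := Fin.ext hk
  rw [hb]
  exact this

/-- **Repeated index forces two close prime factors**: if `τ` is monotone but not strictly, and
`idxList n = ofFn τ` with all prime factors of `n` in `(c_0, c_{J+1}]`, then `p p' ∣ n` for two primes
`c_j < p ≤ p' ≤ c_{j+1}` of one piece `j ≤ J`. [cite: Polymath8b2014, §4.5, p. 17] -/
theorem exists_close_primes_of_not_strictMono (hc : Monotone c) {r : ℕ} {τ : Fin r → ℕ} (hτ : Monotone τ)
    (hns : ¬ StrictMono τ) {n : ℕ} (hfac : ∀ p ∈ n.primeFactorsList, c 0 < p ∧ p ≤ c (J + 1))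
    (hidx : idxList c J n = List.ofFn τ) :
    ∃ j p p', j ≤ J ∧ p.Prime ∧ p'.Prime ∧ c j < p ∧ p ≤ p' ∧ p' ≤ c (j + 1) ∧ p * p' ∣ n := by
  obtain ⟨i, hi, heq⟩ := exists_eq_succ_of_not_strictMono hτ hns
  set ps := n.primeFactorsList with hps
  have hlen : ps.length = r := by
    have : (idxList c J n).length = r := by rw [hidx, List.length_ofFn]
    rwa [idxList, List.length_map] at this
  have hi0 : i < ps.length := by omega
  have hi1 : i + 1 < ps.length := by omega
  set p := ps[i] with hp
  set p' := ps[i + 1] with hp'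
  have hpmem : p ∈ ps := List.getElem_mem hi0
  have hp'mem : p' ∈ ps := List.getElem_mem hi1
  have hpp : p.Prime := Nat.prime_of_mem_primeFactorsList hpmem
  have hpp' : p'.Prime := Nat.prime_of_mem_primeFactorsList hp'mem
  -- indices
  have hidxi : ∀ (k : ℕ) (hk : k < ps.length), gridIndex c J ps[k] = τ ⟨k, hlen ▸ hk⟩ := by
    intro k hk
    have h1 : (idxList c J n)[k]'(by rw [idxList, List.length_map]; exact hk) = gridIndex c J ps[k] := by
      simp [idxList, List.getElem_map, hps]
    have h2 : (idxList c J n)[k]'(by rw [idxList, List.length_map]; exact hk) = τ ⟨k, hlen ▸ hk⟩ := by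
      simp [hidx, List.getElem_ofFn]
    rw [← h1, h2]
  set j := τ ⟨i, by omega⟩ with hj
  have hjp : gridIndex c J p = j := hidxi i hi0
  have hjp' : gridIndex c J p' = j := by rw [hidxi (i + 1) hi1]; exact heq.symm
  obtain ⟨hjJ, h1, h2⟩ := gridIndex_spec hc (hfac p hpmem).1 (hfac p hpmem).2
  obtain ⟨-, h1', h2'⟩ := gridIndex_spec hc (hfac p' hp'mem).1 (hfac p' hp'mem).2
  rw [hjp] at hjJ h1 h2
  rw [hjp'] at h1' h2'
  -- `p ≤ p'` (sorted) and `p p' ∣ n` (consecutive sublist)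
  have hsorted := Nat.primeFactorsList_sorted n
  have hle : p ≤ p' := by
    rw [List.sortedLE_iff_getElem_le_getElem_of_le] at hsorted
    exact hsorted (Nat.le_succ i)
  have hsub : [p, p'].Sublist ps := by
    have h := List.Sublist.trans (List.take_sublist 2 (ps.drop i)) (List.drop_sublist i ps)
    have htake : (ps.drop i).take 2 = [p, p'] := by
      apply List.ext_getElem
      · simp only [List.length_take, List.length_drop, List.length_cons, List.length_nil]
        omega
      · intro k hk1 hk2
        simp only [List.length_cons, List.length_nil] at hk2
        simp only [List.getElem_take, List.getElem_drop]
        match k, hk2 with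
        | 0, _ => simp [hp]
        | 1, _ => simp [hp']
    rwa [htake] at h
  have hdvd : p * p' ∣ n := by
    have := hsub.prod_dvd_prod
    rw [List.prod_cons, List.prod_singleton, Nat.prod_primeFactorsList] at this
    · exact this
    · rintro rfl
      simp [hps] at hi0
  exact ⟨j, p, p', hjJ, hpp, hpp', h1, hle, h2', hdvd⟩

end Repeated

end Literature.NumberTheory.Sieve
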